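import Literature.AlgebraicGeometry.Motives.DivisorOfSectionCohomologySequence
import Literature.AlgebraicGeometry.HodgeTheory.BlochSemiregularityMapReal
import HarnessLib

/-!
# Bloch (1.1) in the tree's `normalSheaf` currency: the semiregularity map of a divisor
# `π : Hⁿ(Z, 𝒩_{Z/X}) → Hⁿ⁺¹(X, 𝒪_X)` as the boundary map of `0 → 𝒪_X →ᵗ 𝓛 → 𝓛|_Z → 0`

Layer `Literature/AlgebraicGeometry/HodgeTheory` (literature-typing tranche LT-H1 «semiregularity consumers», cell
`pub-hsemireg`, width seat lit-4 g7, FILE 3). ASSEMBLY, everything PROVED: two definitions with bodies and theorems, no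
named fact, no `instance`, no notation, no `sorry` (D-0026: net debt 0).

## What is printed

* [Bloch1972Semiregularity, §0, p. 51, lines 8–9]: «`Z` is said to be *semi-regular* if `π` is injective.»
* [Bloch1972Semiregularity, (1.1) Proposition, p. 52]: «Suppose `Z` is a divisor on `X`. Then the semi-regularity map
  `π : H¹(Z, N) → H²(X, O_X)` arises as the boundary map in the cohomology sequence associated to
  `0 → O_X → O_X(Z) → N → 0`.» — here `N = N_{Z/X}` is the normal sheaf (p. 51: «`N_{Z/X}` the normal sheaf of `Z` in `X`»),
  identified with `O_X(Z)|_Z`.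
* [Bloch1972Semiregularity, p. 53, lines 1–2]: «The notion of semi-regularity for divisors (with the definition of `π`
  given in (1.1)) is due to Kodaira-Spencer [17].»
* [Hartshorne2010, Ex. 6.7 (b), p. 52]: for a curve `Y` on a surface `X`, `𝓛 = 𝒪_X(Y)`: «`⋯ → H¹(𝓛) → H¹(𝓛_Y) →^δ H²(𝒪_X) → ⋯`»,
  and the obstruction theory of `Y ⊂ X` lives in `H¹(Y, 𝒩_{Y/X}) = H¹(𝓛_Y)`.
* [BuchweitzFlenner2003, §1]: `𝒩_{Z/X} = 𝓗om(𝒥, 𝒪_Z) ≅ (𝒥/𝒥²)^∨` — the tree's `HodgeTheory.normalSheaf ι = dual (conormalSheaf ι)`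
  and `normalSheafCohomology ι k = Hᵏ(Z, 𝒩_{Z/X})` (`HodgeTheory/BlochSemiregularityMapReal`).

## What this file types (the divisor case, for every cohomological degree `n`)

Setting = the tree's `Motives/DivisorOfSectionCohomologySequence` (lit-4 g7 FILE 1): `𝓛` a finite locally free
`𝒪_X`-module with a global section `t`, `ι : Z ⟶ X` a closed immersion with `ι.ker = zeroSchemeIdeal 𝓛 t` (`Z = (t)₀`),
hypothesis `(h)` = «near every point some rank-one frame coordinate of `t` is a non-zero-divisor» (effective Cartier
divisor), which gives the short exact sequence `0 → 𝒪_X →ᵗ 𝓛 → ι_*ι^*𝓛 → 0` and its boundary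
`Motives.divisorδ : Hⁿ(Z, ι^*𝓛) → Hⁿ⁺¹(X, 𝒪_X)`; PLUS, as an explicit DATUM, an isomorphism of `𝒪_Z`-modules
`φ : normalSheaf ι ≅ ι^*𝓛` («`N ≅ 𝒪_X(Z)|_Z`»; for `Z = Z(t)` with regular frame coordinates such an isomorphism is
produced by the tree's lit-10 file `HodgeTheory/ZeroSchemeNormalSheaf` (`nonempty_normalSheaf_zeroSchemeι_iso_pullback`,
Fulton, *Intersection Theory*, B.6.3 (a)); this file does not choose one — every statement below is invariant under the choice).

* §1 `normalCohomologyEquiv ι φ n : Hⁿ(Z, 𝒩_{Z/X}) ≃+ Hⁿ(Z, ι^*𝓛)` (`Hⁿ(φ)`, tree `Modules.sheafAddEquivH`) and the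
  restriction `restrictNormalCohomology ι φ n : Hⁿ(X, 𝓛) → Hⁿ(Z, 𝒩_{Z/X})` (`= Hⁿ(φ)⁻¹ ∘ (Hⁿ(X, 𝓛) → Hⁿ(Z, ι^*𝓛))`).
* §2 **`divisorSemiregularityMap … φ n : Hⁿ(Z, 𝒩_{Z/X}) →+ Hⁿ⁺¹(X, 𝒪_X)`** `:= divisorδ ∘ Hⁿ(φ)` — for `n = 1` this is
  Bloch's `π` of (1.1) — and the long exact sequence around it:
  `Hⁿ(X, 𝒪_X) →ᵗ Hⁿ(X, 𝓛) → Hⁿ(Z, 𝒩) →π Hⁿ⁺¹(X, 𝒪_X) →ᵗ Hⁿ⁺¹(X, 𝓛)` is exact at the three inner spots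
  (`exact_mulSectionCohomology_restrictNormalCohomology`, `exact_restrictNormalCohomology_divisorSemiregularityMap`,
  `exact_divisorSemiregularityMap_mulSectionCohomology`).
* §3 Semiregularity read through one line of exactness (Bloch p. 51 «semi-regular iff `π` injective», divisor case):
  `π` injective ⟺ `Hⁿ(X, 𝓛) → Hⁿ(Z, 𝒩)` is zero ⟺ `Hⁿ(t) : Hⁿ(X, 𝒪_X) → Hⁿ(X, 𝓛)` onto; sufficient: `Hⁿ(X, 𝓛) = 0`
  (`n = 1`: «`H¹(X, 𝒪_X(Z)) = 0 ⇒ Z` semi-regular», the Kodaira–Spencer/Severi condition); dually `π` onto ⟺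
  `Hⁿ⁺¹(t) = 0`, in particular when `Hⁿ⁺¹(X, 𝓛) = 0`.

## HONEST SCOPE

(1) `φ : 𝒩_{Z/X} ≅ ι^*𝓛` is a hypothesis (data), never derived here. (2) Nothing identifies this `π` (divisor case,
boundary map) with the tree's Hodge-theoretic predicate `HodgeTheory.IsBlochSemiregular i n p` for `p = 1` (that is
Bloch's duality statement (1.1) ⇐ §1 definition via Grothendieck duality, not typed); the two files
`BlochSemiregularHypersurfaceCriterion` / `…TrivialCanonical` read the `p = 1` predicate on the FORMS side instead.
(3) No statement about Hilbert schemes ((1.2) of Bloch = Kodaira–Spencer's theorem is not typed). (4) Ground scheme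
arbitrary; no smoothness, properness or characteristic hypothesis is used or asserted.

* Searched (tree + Mathlib pin): `normalSheafCohomology` has no map to `Hⁿ⁺¹(X, 𝒪_X)` in the tree except through
  `IsBlochSemiregular` (forms side) and the local-Hilbert-functor obstruction files (`Deformation/…`, `H¹(Z, 𝒩)` as
  obstruction space, no boundary map); `Motives.divisorδ` (FILE 1) is stated on `Hⁿ(Z, ι^*𝓛)`. Nothing restated.
-/

noncomputable section

-- `TopCat.Presheaf`/`Scheme.Modules` are not reducible (as in Mathlib's `AlgebraicGeometry/Modules/Sheaf.lean` and the
-- tree's `Motives/ClosedSubschemeRestrictionSequence.lean`).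
set_option backward.isDefEq.respectTransparency false

open CategoryTheory Limits Opposite TopologicalSpace Abelian AlgebraicGeometry

universe u

namespace Literature.AlgebraicGeometry.HodgeTheory

open Literature.AlgebraicGeometry.Modules Literature.AlgebraicGeometry.Motives

variable {X Z : Scheme.{u}} (ι : Z ⟶ X) {L : X.Modules}

/-! ## §1 `Hⁿ(φ) : Hⁿ(Z, 𝒩_{Z/X}) ≃ Hⁿ(Z, ι^*𝓛)` and the restriction `Hⁿ(X, 𝓛) → Hⁿ(Z, 𝒩_{Z/X})` -/

section NormalIso

variable (φ : normalSheaf ι ≅ (Scheme.Modules.pullback ι).obj L)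

/-- **`Hⁿ(φ) : Hⁿ(Z, 𝒩_{Z/X}) ≃+ Hⁿ(Z, ι^*𝓛)`**, the isomorphism on cohomology induced by an isomorphism
`φ : 𝒩_{Z/X} ≅ ι^*𝓛 = 𝓛|_Z` («`N = 𝒪_X(Z)|_Z`»; tree `Modules.sheafAddEquivH`). Definition with body.
[cite: Bloch1972Semiregularity, (1.1) Proposition, p. 52] [cite: Hartshorne1977, III §2 (cohomology functors), p. 207] -/
def normalCohomologyEquiv (n : ℕ) :
    normalSheafCohomology ι n ≃+
      Sheaf.H ((SheafOfModules.toSheaf Z.ringCatSheaf).obj ((Scheme.Modules.pullback ι).obj L)) n :=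
  sheafAddEquivH ((SheafOfModules.toSheaf Z.ringCatSheaf).mapIso φ) n

/-- Unfolding: `normalCohomologyEquiv ι φ n = Hⁿ(φ.hom)`. [cite: Hartshorne1977, III §2, p. 207] -/
theorem normalCohomologyEquiv_apply (n : ℕ) (y : normalSheafCohomology ι n) :
    normalCohomologyEquiv ι φ n y = moduleSheafCohomology.map φ.hom n y :=
  rfl

/-- Unfolding: `(normalCohomologyEquiv ι φ n).symm = Hⁿ(φ.inv)`. [cite: Hartshorne1977, III §2, p. 207] -/
theorem normalCohomologyEquiv_symm_apply (n : ℕ)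
    (z : Sheaf.H ((SheafOfModules.toSheaf Z.ringCatSheaf).obj ((Scheme.Modules.pullback ι).obj L)) n) :
    (normalCohomologyEquiv ι φ n).symm z = moduleSheafCohomology.map φ.inv n z :=
  rfl

variable [IsClosedImmersion ι]

/-- **The restriction `Hⁿ(X, 𝓛) → Hⁿ(Z, 𝒩_{Z/X})`** («`H¹(𝓛) → H¹(𝓛_Y) = H¹(Y, 𝒩_{Y/X})`»): the tree's restriction
`Motives.restrictCohomologyOf ι 𝓛 n : Hⁿ(X, 𝓛) → Hⁿ(Z, ι^*𝓛)` followed by `Hⁿ(φ)⁻¹`. Definition with body.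
[cite: Hartshorne2010, Ex. 6.7 (b), p. 52] [cite: Hartshorne1977, III Lemma 2.10, p. 209] -/
def restrictNormalCohomology (n : ℕ) :
    Sheaf.H ((SheafOfModules.toSheaf X.ringCatSheaf).obj L) n →+ normalSheafCohomology ι n :=
  (normalCohomologyEquiv ι φ n).symm.toAddMonoidHom.comp (restrictCohomologyOf ι L n)

/-- Unfolding `restrictNormalCohomology`. [cite: Hartshorne2010, Ex. 6.7 (b), p. 52] -/
theorem restrictNormalCohomology_apply (n : ℕ) (x : Sheaf.H ((SheafOfModules.toSheaf X.ringCatSheaf).obj L) n) :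
    restrictNormalCohomology ι φ n x = (normalCohomologyEquiv ι φ n).symm (restrictCohomologyOf ι L n x) :=
  rfl

/-- `Hⁿ(φ) ∘ (Hⁿ(X, 𝓛) → Hⁿ(Z, 𝒩)) = (Hⁿ(X, 𝓛) → Hⁿ(Z, ι^*𝓛))`. [cite: Hartshorne2010, Ex. 6.7 (b), p. 52] -/
theorem normalCohomologyEquiv_restrictNormalCohomology (n : ℕ)
    (x : Sheaf.H ((SheafOfModules.toSheaf X.ringCatSheaf).obj L) n) :
    normalCohomologyEquiv ι φ n (restrictNormalCohomology ι φ n x) = restrictCohomologyOf ι L n x := by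
  rw [restrictNormalCohomology_apply, AddEquiv.apply_symm_apply]

/-- **`Hⁿ(X, 𝓛) → Hⁿ(Z, 𝒩_{Z/X})` is zero iff `Hⁿ(X, 𝓛) → Hⁿ(Z, ι^*𝓛)` is zero** (the two restrictions differ by the
isomorphism `Hⁿ(φ)`). [cite: Hartshorne2010, Ex. 6.7 (b), p. 52] -/
theorem restrictNormalCohomology_eq_zero_iff (n : ℕ) :
    restrictNormalCohomology ι φ n = 0 ↔ restrictCohomologyOf ι L n = 0 := by
  constructor
  · intro h0
    ext x
    rw [← normalCohomologyEquiv_restrictNormalCohomology ι φ n x, h0, AddMonoidHom.zero_apply, map_zero,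
      AddMonoidHom.zero_apply]
  · intro h0
    ext x
    rw [restrictNormalCohomology_apply, h0, AddMonoidHom.zero_apply, map_zero, AddMonoidHom.zero_apply]

end NormalIso

/-! ## §2 Bloch's `π = δ : Hⁿ(Z, 𝒩_{Z/X}) → Hⁿ⁺¹(X, 𝒪_X)` and the long exact sequence around it -/

section Divisor

variable {I : Type u} [Fintype I] (hL : IsFiniteLocallyFree L) (t : Γ(L, ⊤))
  (hι : ι.ker = zeroSchemeIdeal L t)
  (h : ∀ x : X, ∃ (V : X.affineOpens) (W : X.Opens) (k : (V : X.Opens) ⟶ W)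
    (e : SheafOfModules.free I ≅ L.over W) (σ : Fin 1 ≃ I),
    x ∈ (V : X.Opens) ∧
      RingTheory.Sequence.IsWeaklyRegular Γ(X, (V : X.Opens)) (List.ofFn fun j => coord e k (resTop L t V) (σ j)))
  [IsClosedImmersion ι] (φ : normalSheaf ι ≅ (Scheme.Modules.pullback ι).obj L)

/-- **The semiregularity map of the divisor `Z = (t)₀`, `π : Hⁿ(Z, 𝒩_{Z/X}) → Hⁿ⁺¹(X, 𝒪_X)`** — «the semi-regularity map
`π : H¹(Z, N) → H²(X, O_X)` arises as the boundary map in the cohomology sequence associated to `0 → O_X → O_X(Z) → N → 0`»: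
the boundary `Motives.divisorδ` of `0 → 𝒪_X →ᵗ 𝓛 → ι_*ι^*𝓛 → 0` (tree FILE `Motives/DivisorOfSectionCohomologySequence`)
precomposed with `Hⁿ(φ)`, `φ : 𝒩_{Z/X} ≅ ι^*𝓛` the given identification `N ≅ 𝒪_X(Z)|_Z`. Stated for every degree `n`
(`n = 1` is Bloch's `π`; the notion is Kodaira–Spencer's, Bloch p. 53). Definition with body.
[cite: Bloch1972Semiregularity, (1.1) Proposition, p. 52] [cite: Hartshorne2010, Ex. 6.7 (b), p. 52] -/
def divisorSemiregularityMap (n : ℕ) :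
    normalSheafCohomology ι n →+ Sheaf.H ((SheafOfModules.toSheaf X.ringCatSheaf).obj (unitModule X)) (n + 1) :=
  (divisorδ hL t ι hι h n).comp (normalCohomologyEquiv ι φ n).toAddMonoidHom

/-- Unfolding: `π y = δ (Hⁿ(φ) y)`. [cite: Bloch1972Semiregularity, (1.1) Proposition, p. 52] -/
theorem divisorSemiregularityMap_apply (n : ℕ) (y : normalSheafCohomology ι n) :
    divisorSemiregularityMap ι hL t hι h φ n y = divisorδ hL t ι hι h n (normalCohomologyEquiv ι φ n y) :=
  rfl

/-- `π ∘ Hⁿ(φ)⁻¹ = δ`. [cite: Bloch1972Semiregularity, (1.1) Proposition, p. 52] -/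
theorem divisorSemiregularityMap_symm_apply (n : ℕ)
    (z : Sheaf.H ((SheafOfModules.toSheaf Z.ringCatSheaf).obj ((Scheme.Modules.pullback ι).obj L)) n) :
    divisorSemiregularityMap ι hL t hι h φ n ((normalCohomologyEquiv ι φ n).symm z) = divisorδ hL t ι hι h n z := by
  rw [divisorSemiregularityMap_apply, AddEquiv.apply_symm_apply]

include hL hι h in
/-- **Exactness at `Hⁿ(X, 𝓛)`**: `Hⁿ(X, 𝒪_X) →ᵗ Hⁿ(X, 𝓛) → Hⁿ(Z, 𝒩_{Z/X})` is exact — a class restricts to zero in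
`Hⁿ(Z, 𝒩)` iff it is a multiple `Hⁿ(t)(y)` of the section. [cite: Hartshorne2010, Ex. 6.7 (b), p. 52]
[cite: Hartshorne1977, III Thm. 1.1A (c), p. 204] -/
theorem exact_mulSectionCohomology_restrictNormalCohomology (n : ℕ) :
    Function.Exact (mulSectionCohomology L t n) (restrictNormalCohomology ι φ n) :=
  (exact_mulSectionCohomology_restrictCohomologyOf hL t ι hι h n).comp_injective (normalCohomologyEquiv ι φ n).symm
    (normalCohomologyEquiv ι φ n).symm.injective (map_zero _)

/-- **Exactness at `Hⁿ(Z, 𝒩_{Z/X})`**: `Hⁿ(X, 𝓛) → Hⁿ(Z, 𝒩_{Z/X}) →π Hⁿ⁺¹(X, 𝒪_X)` is exact — `ker π` is the image of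
`Hⁿ(X, 𝓛)` («`⋯ → H¹(𝓛) → H¹(𝓛_Y) →^δ H²(𝒪_X) → ⋯`»). [cite: Bloch1972Semiregularity, (1.1) Proposition, p. 52]
[cite: Hartshorne2010, Ex. 6.7 (b), p. 52] -/
theorem exact_restrictNormalCohomology_divisorSemiregularityMap (n : ℕ) :
    Function.Exact (restrictNormalCohomology ι φ n) (divisorSemiregularityMap ι hL t hι h φ n) := by
  intro y
  rw [divisorSemiregularityMap_apply, exact_restrictCohomologyOf_divisorδ hL t ι hι h n]
  constructor
  · rintro ⟨x, hx⟩
    exact ⟨x, by rw [restrictNormalCohomology_apply, hx, AddEquiv.symm_apply_apply]⟩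
  · rintro ⟨x, rfl⟩
    exact ⟨x, (normalCohomologyEquiv_restrictNormalCohomology ι φ n x).symm⟩

/-- **Exactness at `Hⁿ⁺¹(X, 𝒪_X)`**: `Hⁿ(Z, 𝒩_{Z/X}) →π Hⁿ⁺¹(X, 𝒪_X) →ᵗ Hⁿ⁺¹(X, 𝓛)` is exact — the image of `π` is the
kernel of `Hⁿ⁺¹(t)`. [cite: Bloch1972Semiregularity, (1.1) Proposition, p. 52] [cite: Hartshorne2010, Ex. 6.7 (b), p. 52] -/
theorem exact_divisorSemiregularityMap_mulSectionCohomology (n : ℕ) :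
    Function.Exact (divisorSemiregularityMap ι hL t hι h φ n) (mulSectionCohomology L t (n + 1)) := by
  intro w
  rw [exact_divisorδ_mulSectionCohomology hL t ι hι h n w]
  constructor
  · rintro ⟨z, rfl⟩
    exact ⟨(normalCohomologyEquiv ι φ n).symm z, divisorSemiregularityMap_symm_apply ι hL t hι h φ n z⟩
  · rintro ⟨y, rfl⟩
    exact ⟨normalCohomologyEquiv ι φ n y, rfl⟩

/-! ## §3 «`Z` is semi-regular iff `π` is injective» read through the sequence -/

/-- `π` is injective iff `δ : Hⁿ(Z, ι^*𝓛) → Hⁿ⁺¹(X, 𝒪_X)` is (they differ by the isomorphism `Hⁿ(φ)`).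
[cite: Bloch1972Semiregularity, (1.1) Proposition, p. 52] -/
theorem divisorSemiregularityMap_injective_iff_divisorδ_injective (n : ℕ) :
    Function.Injective (divisorSemiregularityMap ι hL t hι h φ n) ↔ Function.Injective (divisorδ hL t ι hι h n) :=
  Function.Injective.of_comp_iff' (divisorδ hL t ι hι h n) (normalCohomologyEquiv ι φ n).bijective

/-- **`π : Hⁿ(Z, 𝒩_{Z/X}) → Hⁿ⁺¹(X, 𝒪_X)` is injective iff the restriction `Hⁿ(X, 𝓛) → Hⁿ(Z, 𝒩_{Z/X})` is zero** (`n = 1`: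
the divisor `Z` is semi-regular — «`Z` is said to be semi-regular if `π` is injective» — iff `H¹(X, 𝒪_X(Z)) → H¹(Z, N)`
is the zero map, Kodaira–Spencer's formulation). [cite: Bloch1972Semiregularity, §0 p. 51 (definition) and (1.1) Proposition, p. 52]
[cite: Hartshorne2010, Ex. 6.7 (b), p. 52] -/
theorem divisorSemiregularityMap_injective_iff (n : ℕ) :
    Function.Injective (divisorSemiregularityMap ι hL t hι h φ n) ↔ restrictNormalCohomology ι φ n = 0 := by
  rw [divisorSemiregularityMap_injective_iff_divisorδ_injective, divisorδ_injective_iff,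
    restrictNormalCohomology_eq_zero_iff]

/-- **`π` is injective iff `Hⁿ(t) : Hⁿ(X, 𝒪_X) → Hⁿ(X, 𝓛)` is surjective** (`n = 1`: `Z` is semi-regular iff
`H¹(X, 𝒪_X) → H¹(X, 𝒪_X(Z))` is onto). [cite: Bloch1972Semiregularity, (1.1) Proposition, p. 52]
[cite: Hartshorne2010, Ex. 6.7 (b), p. 52] -/
theorem divisorSemiregularityMap_injective_iff_mulSectionCohomology_surjective (n : ℕ) :
    Function.Injective (divisorSemiregularityMap ι hL t hι h φ n) ↔ Function.Surjective (mulSectionCohomology L t n) := by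
  rw [divisorSemiregularityMap_injective_iff_divisorδ_injective,
    divisorδ_injective_iff_mulSectionCohomology_surjective]

/-- **`Hⁿ(X, 𝓛) = 0 ⇒ π` injective** (`n = 1`: «if `H¹(X, 𝒪_X(Z)) = 0` then the divisor `Z` is semi-regular», the
classical sufficient condition of Severi–Kodaira–Spencer). [cite: Bloch1972Semiregularity, (1.1) Proposition, p. 52 and p. 53 lines 1–2]
[cite: Hartshorne2010, Ex. 6.7 (b), p. 52] -/
theorem divisorSemiregularityMap_injective_of_subsingleton (n : ℕ)
    [Subsingleton (Sheaf.H ((SheafOfModules.toSheaf X.ringCatSheaf).obj L) n)] :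
    Function.Injective (divisorSemiregularityMap ι hL t hι h φ n) :=
  (divisorSemiregularityMap_injective_iff_divisorδ_injective ι hL t hι h φ n).mpr
    (divisorδ_injective_of_subsingleton hL t ι hι h n)

/-- **`Hⁿ(X, 𝒪_X) = 0 ⇒` (`π` injective iff `Hⁿ(X, 𝓛) → Hⁿ(Z, 𝒩)` is injective… ) — precisely: if `Hⁿ(X, 𝒪_X) = 0` then
`π` is injective iff `Hⁿ(X, 𝓛) = 0`** (exactness at `Hⁿ(X, 𝓛)` makes the restriction injective, so it is zero iff its
source vanishes; `n = 1`, `X` with `H¹(X, 𝒪_X) = 0` — e.g. a K3 or a regular surface: `Z` semi-regular iff `H¹(X, 𝒪_X(Z)) = 0`).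
[cite: Bloch1972Semiregularity, (1.1) Proposition, p. 52] [cite: Hartshorne2010, Ex. 6.7 (b), p. 52] -/
theorem divisorSemiregularityMap_injective_iff_subsingleton_of_subsingleton_unit (n : ℕ)
    [Subsingleton (Sheaf.H ((SheafOfModules.toSheaf X.ringCatSheaf).obj (unitModule X)) n)] :
    Function.Injective (divisorSemiregularityMap ι hL t hι h φ n) ↔
      Subsingleton (Sheaf.H ((SheafOfModules.toSheaf X.ringCatSheaf).obj L) n) := by
  rw [divisorSemiregularityMap_injective_iff_mulSectionCohomology_surjective]
  constructor
  · intro hsurj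
    refine ⟨fun a b => ?_⟩
    obtain ⟨a', rfl⟩ := hsurj a
    obtain ⟨b', rfl⟩ := hsurj b
    rw [Subsingleton.elim a' b']
  · intro _ a
    exact ⟨0, Subsingleton.elim _ _⟩

/-- `π` is surjective iff `δ` is. [cite: Bloch1972Semiregularity, (1.1) Proposition, p. 52] -/
theorem divisorSemiregularityMap_surjective_iff_divisorδ_surjective (n : ℕ) :
    Function.Surjective (divisorSemiregularityMap ι hL t hι h φ n) ↔ Function.Surjective (divisorδ hL t ι hι h n) :=
  Function.Surjective.of_comp_iff (divisorδ hL t ι hι h n) (normalCohomologyEquiv ι φ n).surjective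

/-- **`π : Hⁿ(Z, 𝒩_{Z/X}) → Hⁿ⁺¹(X, 𝒪_X)` is surjective iff `Hⁿ⁺¹(t) : Hⁿ⁺¹(X, 𝒪_X) → Hⁿ⁺¹(X, 𝓛)` is zero** (exactness at
`Hⁿ⁺¹(X, 𝒪_X)`). [cite: Bloch1972Semiregularity, (1.1) Proposition, p. 52] [cite: Hartshorne2010, Ex. 6.7 (b), p. 52] -/
theorem divisorSemiregularityMap_surjective_iff (n : ℕ) :
    Function.Surjective (divisorSemiregularityMap ι hL t hι h φ n) ↔ mulSectionCohomology L t (n + 1) = 0 := by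
  constructor
  · intro hsurj
    ext w
    obtain ⟨y, rfl⟩ := hsurj w
    rw [AddMonoidHom.zero_apply]
    exact ((exact_divisorSemiregularityMap_mulSectionCohomology ι hL t hι h φ n) _).mpr ⟨y, rfl⟩
  · intro h0 w
    exact ((exact_divisorSemiregularityMap_mulSectionCohomology ι hL t hι h φ n) w).mp
      (by rw [h0, AddMonoidHom.zero_apply])

/-- **`Hⁿ⁺¹(X, 𝓛) = 0 ⇒ π` surjective** (`n = 1`: `H²(X, 𝒪_X(Z)) = 0 ⇒ π : H¹(Z, 𝒩) → H²(X, 𝒪_X)` onto).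
[cite: Bloch1972Semiregularity, (1.1) Proposition, p. 52] [cite: Hartshorne2010, Ex. 6.7 (b), p. 52] -/
theorem divisorSemiregularityMap_surjective_of_subsingleton (n : ℕ)
    [Subsingleton (Sheaf.H ((SheafOfModules.toSheaf X.ringCatSheaf).obj L) (n + 1))] :
    Function.Surjective (divisorSemiregularityMap ι hL t hι h φ n) :=
  (divisorSemiregularityMap_surjective_iff_divisorδ_surjective ι hL t hι h φ n).mpr
    (divisorδ_surjective_of_subsingleton hL t ι hι h n)

include hL t hι h in
/-- **`Hⁿ⁺¹(X, 𝒪_X) = 0 ⇒` the restriction `Hⁿ(X, 𝓛) → Hⁿ(Z, 𝒩_{Z/X})` is surjective** (`n = 0`, `H¹(X, 𝒪_X) = 0`: every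
section of `𝒩_{Z/X} ≅ 𝒪_Z(Z)` lifts to a section of `𝒪_X(Z)` — the regular-surface case of the completeness of the
characteristic system). [cite: Hartshorne2010, Ex. 6.7 (b), p. 52] [cite: Bloch1972Semiregularity, (1.1) Proposition, p. 52] -/
theorem restrictNormalCohomology_surjective_of_subsingleton_unit (n : ℕ)
    [Subsingleton (Sheaf.H ((SheafOfModules.toSheaf X.ringCatSheaf).obj (unitModule X)) (n + 1))] :
    Function.Surjective (restrictNormalCohomology ι φ n) := fun y =>
  ((exact_restrictNormalCohomology_divisorSemiregularityMap ι hL t hι h φ n) y).mp (Subsingleton.elim _ _)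

end Divisor

end Literature.AlgebraicGeometry.HodgeTheory

end
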